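import Literature.NumberTheory.GelbartRogawski1991.UnitaryDualPairThetaKernelCM
import Literature.NumberTheory.Weil1964.AdelicMetaplecticScalarTwist
import Literature.NumberTheory.Automorphic.UnitaryGroupAdelicCenter
import HarnessLib

/-!
# The CM dual pair's theta-kernel datum with a NORMALISED pair splitting `s_pair ⊗ η`, and its central
# character on the anti-diagonal centre

[GelbartRogawski1991, §3.1 Remark p. 457 L4–13]: two compatible splittings of `G₁(𝐀) → Mp` differ by an
automorphic character with values in the central `ℂ*` ("`s* = s ⊗ ν′`").  The `K_∞`-TYPE NORMALISATION of the
CM dual pair's splitting (the tree's `Weil1964.AdelicMetaplecticScalarTwist`: `adelicMpCont.twist s η (h) =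
(1, η(h)·id) · s(h)`) is applied here at the PAIR level: for a character
`η : U(diag dV)(𝔸_{L⁺}) × U(diag dW)(𝔸_{L⁺}) →* ℂˣ` the normalised pair splitting is
`cmPairSplittingTwist hGR η := cmPairSplitting hGR ⊗ η`, and everything the un-normalised CM datum
(`UnitaryDualPairThetaKernelCM`, `…CMKType`) provides transfers VERBATIM from the generic twist API:
the projection to `Sp(𝕎_𝔸)` is unchanged (`proj_cmPairSplittingTwist`), continuity (`continuous_cmPairSplittingTwist`,
from `hηc : Continuous η`), the Weil action is `η • (ω_ψ ∘ s_pair)` (`cmPairRepTwist_apply_eq_smul`, definitional),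
Weil's Théorème 6 on the rational points survives as soon as `η` is trivial there (`hη`;
`cmPairRepTwist_toHomUnits_mem_thetaStabilizer`), Weil's majorants survive (`hasThetaMajorants_cmPairRepTwist`,
[Weil1964, n° 41 Lemme 5]), so Weil's datum `ThetaKernelDatum.adelicOfDualPairRep` is available for the twisted
representation (`cmThetaKernelDatumTwist`).  (The `K_∞`-type bookkeeping under the normalisation — the
`χ′`-isotypic `K_∞`-type of the twisted representation is the `χ′ / (η ∘ (e, 1))`-isotypic one of the original —
and the datum with its `K`-type pinned are in the companion file `UnitaryDualPairThetaKernelCMTwistKType`.)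

THE ANTI-DIAGONAL CENTRE.  Along `Z⁻ = {(u · 1_V, u⁻¹ · 1_W) | u ∈ U(1)(𝔸_{L⁺})}`
(`UnitaryGroup.adelicCenter`, `UnitaryGroupAdelicCenter`) the pair `(u · 1_V, u⁻¹ · 1_W)` maps to `1 ∈ G₁(𝔸)`, so
the Gelbart–Rogawski pair splitting — a RESTRICTION of a homomorphism on `G₁(𝔸)` — is IDENTICALLY `1` there
(`cmPairSplitting_center`, kernel), `ω_ψ ∘ s_pair` acts trivially (`cmPairRep_center`), and the normalised splitting
takes the central value `(1, η(u · 1_V, u⁻¹ · 1_W) · id)` (`cmPairSplittingTwist_center`): **the central character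
of the normalised CM datum on `Z⁻` is exactly `u ↦ η(u · 1_V, u⁻¹ · 1_W)`** (`cmPairRepTwist_center`).  Kudla's
splittings `ι̃_{V,χ} ≃ (ι_V, β_{V,χ})` ([HarrisKudlaSweet1996, (1.14)–(1.15) p. 952]) have in general a
NON-trivial character `β_{V,χ_V}(z) β_{W,μ}(z⁻¹)` on `Z⁻`; matching a prescribed central character `β` is
therefore the CONSTRAINT `η(u · 1_V, u⁻¹ · 1_W) = β(u)` on the normalising character, recorded as the
hypothesis-predicate `CenterCharEq η β` with its consequence `cmPairRepTwist_center_of_centerCharEq`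
(`(ω_ψ ∘ (s_pair ⊗ η))(u · 1_V, u⁻¹ · 1_W) Φ = β(u) • Φ`).  Nothing about `β` is asserted here.

* §1 `cmPairSplittingTwist`, `cmPairRepTwist` (+ `_apply`, `_apply_eq_smul`, `proj_`, `continuous_`,
  Θ-stabiliser, majorants), `cmThetaKernelDatumTwist` (+ `_s`, `_act`, `_SK`, `_thetaFun_mk`, continuity,
  right-invariance under the rational points);
* §2 the centre: `cmPairSplitting_center`, `cmPairRep_center`, `cmPairSplittingTwist_center`, `cmPairRepTwist_center`,
  `CenterCharEq`, `cmPairRepTwist_center_of_centerCharEq`;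
* §0 reducible shorthands `CMAdelic`, `CMRat`, `CMGram`, `CMSchwartz`, `CMAdelicOne`, `CMCenter` for the CM currency of
  `UnitaryDualPairThetaKernelCM` / `UnitaryGroupAdelicCenter` (abbreviations only, no new objects).

Kernel only; 0 records; 0 named facts; one hypothesis PREDICATE (`CenterCharEq`, a constraint on `η`, never
asserted).  Proof style as in `AdelicMetaplecticScalarTwist` §2: identities in
`Mp_ψ(𝕎_𝔸)ᶜᵒⁿᵗ` are proved in term mode (`congrArg` / `Eq.trans`), never by `rw` under the subgroup coercions.
-/

noncomputable section

open scoped Matrix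
open NumberField
open Literature.NumberTheory.Automorphic
open Literature.NumberTheory.Weil1964

namespace Literature.NumberTheory.GelbartRogawski1991

namespace UnitaryDualPair

/-! ## §0. Shorthands for the CM currency of `UnitaryDualPairThetaKernelCM` (reducible) -/

section Shorthands

variable (L : Type) [Field L] [NumberField L] [IsCMField L]

/-- shorthand (reducible): `U(diag d)(𝔸_{L⁺})`, the adelic points of the unitary group of the diagonal hermitian
form `diag d` over `L/L⁺`, in the `UnitaryGroup.adelic` currency of `UnitaryDualPairThetaKernelCM`. [folklore] -/
abbrev CMAdelic {N : ℕ} (d : Fin N → L) : Type :=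
  ↥(UnitaryGroup.adelic (↥(maximalRealSubfield L)) L (IsCMField.complexConj L) N (Matrix.diagonal d))

/-- shorthand (reducible): the rational points `U(diag d)(L⁺) ≤ U(diag d)(𝔸_{L⁺})` (the range of
`UnitaryGroup.toAdelic`). [folklore] -/
abbrev CMRat {N : ℕ} (d : Fin N → L) : Subgroup (CMAdelic L d) :=
  (UnitaryGroup.toAdelic (↥(maximalRealSubfield L)) L (IsCMField.complexConj L) N (Matrix.diagonal d)).range

/-- shorthand (reducible): the adelic Gram matrix of `𝕎 = Res_{L/L⁺}(V ⊗ W)` for `V = diag dV`, `W = diag dW`,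
re-indexed by `e` (`adelicGram` of the real diagonal Gram matrices). [folklore] -/
abbrev CMGram {N M n : ℕ} (e : Fin N × Fin M ≃ Fin n) (dV : Fin N → L)
    (hdV : ∀ i, IsCMField.complexConj L (dV i) = dV i) (dW : Fin M → L)
    (hdW : ∀ i, IsCMField.complexConj L (dW i) = dW i) :=
  adelicGram (↥(maximalRealSubfield L)) e (realDiagonal L dV hdV) (realDiagonal L dW hdW)

/-- shorthand (reducible): `𝒮(𝔸_{L⁺}^n)`, Weil's adelic Schwartz–Bruhat space `piSchwartzBruhat L⁺ (Fin n)` as a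
type. [folklore] -/
abbrev CMSchwartz (n : ℕ) : Type := ↥(piSchwartzBruhat (↥(maximalRealSubfield L)) (Fin n))

/-- shorthand (reducible): `U(1)(𝔸_{L⁺})` (`UnitaryGroup.adelicOne`) as a type. [cite: Mok2014, §1 Notation p. 5] -/
abbrev CMAdelicOne : Type := ↥(UnitaryGroup.adelicOne (↥(maximalRealSubfield L)) L (IsCMField.complexConj L))

/-- shorthand (reducible): the centre embedding `u ↦ u · 1` of `U(1)(𝔸_{L⁺})` into `U(diag d)(𝔸_{L⁺})`
(`UnitaryGroup.adelicCenter`). [cite: Mok2014, §1 Notation p. 5] -/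
abbrev CMCenter {N : ℕ} (d : Fin N → L) : CMAdelicOne L →* CMAdelic L d :=
  UnitaryGroup.adelicCenter (↥(maximalRealSubfield L)) L (IsCMField.complexConj L) N (Matrix.diagonal d)

end Shorthands

/-! ## §1. The normalised pair splitting and its theta-kernel datum -/

section Twist

variable (L : Type) [Field L] [NumberField L] [IsCMField L] {N M n : ℕ} (e : Fin N × Fin M ≃ Fin n)
variable (dV : Fin N → L) (hdV : ∀ i, IsCMField.complexConj L (dV i) = dV i) (hdV0 : ∀ i, dV i ≠ 0)
variable (dW : Fin M → L) (hdW : ∀ i, IsCMField.complexConj L (dW i) = dW i) (hdW0 : ∀ i, dW i ≠ 0)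
variable (hGR : (cmSplittingDatum L e dV hdV hdV0 dW hdW hdW0).CompatibleSplitting)
variable (η : CMAdelic L dV × CMAdelic L dW →* ℂˣ)

/-- **the normalised pair splitting `s_pair ⊗ η`** of the CM dual pair: `(x, y) ↦ (1, η(x, y)·id) · s_pair(x, y)`
(`Weil1964.adelicMpCont.twist` of `cmPairSplitting hGR`). [cite: GelbartRogawski1991, §3.1 Remark p. 457 L4–13] -/
def cmPairSplittingTwist :
    CMAdelic L dV × CMAdelic L dW →* adelicMpCont (↥(maximalRealSubfield L)) (Fin n) (CMGram L e dV hdV dW hdW) :=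
  adelicMpCont.twist (↥(maximalRealSubfield L)) (Fin n) (CMGram L e dV hdV dW hdW)
    (cmPairSplitting L e dV hdV hdV0 dW hdW hdW0 hGR) η

/-- formula: `(s_pair ⊗ η)(p) = (1, η(p)·id) · s_pair(p)`. [cite: GelbartRogawski1991, §3.1 Remark p. 457 L4–13] -/
theorem cmPairSplittingTwist_apply (p : CMAdelic L dV × CMAdelic L dW) :
    cmPairSplittingTwist L e dV hdV hdV0 dW hdW hdW0 hGR η p =
      adelicMpCont.ofScalar (↥(maximalRealSubfield L)) (Fin n) (CMGram L e dV hdV dW hdW) (η p) *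
        cmPairSplitting L e dV hdV hdV0 dW hdW hdW0 hGR p :=
  adelicMpCont.twist_apply _ _ p

/-- the normalisation does not change the projection: `π((s_pair ⊗ η)(x, y)) = ι(x ⊗ 1 · 1 ⊗ y)`.
[cite: GelbartRogawski1991, §3.1 Prop. 3.1.1 p. 455 L1–3] -/
theorem proj_cmPairSplittingTwist (p : CMAdelic L dV × CMAdelic L dW) :
    adelicMpCont.proj (↥(maximalRealSubfield L)) (Fin n) (CMGram L e dV hdV dW hdW)
        (cmPairSplittingTwist L e dV hdV hdV0 dW hdW hdW0 hGR η p) =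
      (cmSplittingDatum L e dV hdV hdV0 dW hdW hdW0).toSp
        (UnitaryGroup.adelicInl (↥(maximalRealSubfield L)) L (IsCMField.complexConj L) N M
            (Matrix.diagonal dV) (Matrix.diagonal dW) p.1 *
          UnitaryGroup.adelicInr (↥(maximalRealSubfield L)) L (IsCMField.complexConj L) N M
            (Matrix.diagonal dV) (Matrix.diagonal dW) p.2) :=
  (adelicMpCont.proj_twist _ _ p).trans (proj_cmPairSplitting L e dV hdV hdV0 dW hdW hdW0 hGR p)

/-- the normalised pair splitting is continuous for a continuous `η`. [cite: Weil1964, Chap. III n° 39 p. 189] -/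
theorem continuous_cmPairSplittingTwist (hηc : Continuous fun p => ((η p : ℂˣ) : ℂ)) :
    Continuous (cmPairSplittingTwist L e dV hdV hdV0 dW hdW hdW0 hGR η) :=
  adelicMpCont.continuous_twist _ _ (continuous_cmPairSplitting L e dV hdV hdV0 dW hdW hdW0 hGR) hηc

/-- **`ω_ψ ∘ (s_pair ⊗ η)`**, the Weil representation of the CM dual pair in the normalised splitting.
[cite: Weil1964, Chap. III n° 41 p. 193] -/
def cmPairRepTwist : Representation ℂ (CMAdelic L dV × CMAdelic L dW) (CMSchwartz L n) :=
  (adelicMpCont.omega (↥(maximalRealSubfield L)) (Fin n) (CMGram L e dV hdV dW hdW)).comp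
    (cmPairSplittingTwist L e dV hdV hdV0 dW hdW hdW0 hGR η)

/-- `(ω_ψ ∘ (s_pair ⊗ η))(p) Φ = ω_ψ((s_pair ⊗ η)(p)) Φ`. [folklore] -/
@[simp] theorem cmPairRepTwist_apply (p : CMAdelic L dV × CMAdelic L dW) (Φ : CMSchwartz L n) :
    cmPairRepTwist L e dV hdV hdV0 dW hdW hdW0 hGR η p Φ =
      adelicMpCont.omega (↥(maximalRealSubfield L)) (Fin n) (CMGram L e dV hdV dW hdW)
        (cmPairSplittingTwist L e dV hdV hdV0 dW hdW hdW0 hGR η p) Φ := rfl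

/-- **the normalised Weil action is `η • (ω_ψ ∘ s_pair)`**: `(ω_ψ ∘ (s_pair ⊗ η))(p) Φ = η(p) • (ω_ψ ∘ s_pair)(p) Φ`
(definitional, `adelicMpCont.omega_twist`). [cite: GelbartRogawski1991, §3.1 Remark p. 457 L4–13] -/
theorem cmPairRepTwist_apply_eq_smul (p : CMAdelic L dV × CMAdelic L dW) (Φ : CMSchwartz L n) :
    cmPairRepTwist L e dV hdV hdV0 dW hdW hdW0 hGR η p Φ =
      ((η p : ℂˣ) : ℂ) • cmPairRep L e dV hdV hdV0 dW hdW hdW0 hGR p Φ :=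
  adelicMpCont.omega_twist _ _ p Φ

/-- **Weil's Théorème 6 survives the normalisation**: if `η` is trivial on the rational points
`U(diag dV)(L⁺) × U(diag dW)(L⁺)`, then `ω_ψ((s_pair ⊗ η)(γ_U, γ))` fixes `Θ` for rational `γ_U`, `γ` (there the two
splittings agree). [cite: Weil1964, Chap. III n° 41 Thm 6 p. 193; GelbartRogawski1991, §3.1 Remark p. 457 L4–13] -/
theorem cmPairRepTwist_toHomUnits_mem_thetaStabilizer
    (hη : ∀ γU ∈ CMRat L dV, ∀ γ ∈ CMRat L dW, η (γU, γ) = 1)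
    {γU : CMAdelic L dV} (hγU : γU ∈ CMRat L dV) {γ : CMAdelic L dW} (hγ : γ ∈ CMRat L dW) :
    (cmPairRepTwist L e dV hdV hdV0 dW hdW hdW0 hGR η).toHomUnits (γU, γ) ∈
      thetaStabilizer (↥(maximalRealSubfield L)) (Fin n) :=
  (mem_thetaStabilizer_iff _).2 fun Φ =>
    (DFunLike.congr_arg (thetaDistLM (↥(maximalRealSubfield L)) (Fin n))
        (LinearMap.congr_fun
          (adelicMpCont.omega_twist_eq_of_eq_one (cmPairSplitting L e dV hdV hdV0 dW hdW hdW0 hGR) η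
            (hη γU hγU γ hγ)) Φ)).trans
      ((mem_thetaStabilizer_iff _).1
        (cmPairRep_toHomUnits_mem_thetaStabilizer L e dV hdV hdV0 dW hdW hdW0 hGR hγU hγ) Φ)

/-- **Weil's majorants survive the normalisation** (for a continuous `η`), in the literal shape
`HasThetaMajorants fun p Φ => ω_ψ((s_pair ⊗ η) p) Φ`. [cite: Weil1964, Chap. III n° 41, Lemme 5 p. 192] -/
theorem hasThetaMajorants_cmPairRepTwist
    (hρ : HasThetaMajorants fun (p : CMAdelic L dV × CMAdelic L dW) (Φ : CMSchwartz L n) =>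
      adelicMpCont.omega (↥(maximalRealSubfield L)) (Fin n) (CMGram L e dV hdV dW hdW)
        (cmPairSplitting L e dV hdV hdV0 dW hdW hdW0 hGR p) Φ)
    (hηc : Continuous fun p => ((η p : ℂˣ) : ℂ)) :
    HasThetaMajorants fun (p : CMAdelic L dV × CMAdelic L dW) (Φ : CMSchwartz L n) =>
      adelicMpCont.omega (↥(maximalRealSubfield L)) (Fin n) (CMGram L e dV hdV dW hdW)
        (cmPairSplittingTwist L e dV hdV hdV0 dW hdW hdW0 hGR η p) Φ :=
  hasThetaMajorants_twist _ η hρ hηc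

/-- **WEIL'S THETA-KERNEL DATUM OF THE CM DUAL PAIR IN THE NORMALISED SPLITTING `s_pair ⊗ η`, CONSTRUCTED**
(`ThetaKernelDatum.adelicOfDualPairRep` at `ω := ω_ψ ∘ (s_pair ⊗ η)`): hypotheses — [GelbartRogawski1991,
Prop. 3.1.1] at this pair (`hGR`), Weil's majorants for `ω_ψ ∘ s_pair` (`hρ`, the un-normalised shape), `η`
continuous (`hηc`) and trivial on the rational points (`hη`), a `U(diag dW)(𝔸)`-stable `SK`.
[cite: Weil1964, Chap. III n° 41 Thm 6 p. 193] -/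
def cmThetaKernelDatumTwist
    (hρ : HasThetaMajorants fun (p : CMAdelic L dV × CMAdelic L dW) (Φ : CMSchwartz L n) =>
      adelicMpCont.omega (↥(maximalRealSubfield L)) (Fin n) (CMGram L e dV hdV dW hdW)
        (cmPairSplitting L e dV hdV hdV0 dW hdW hdW0 hGR p) Φ)
    (hηc : Continuous fun p => ((η p : ℂˣ) : ℂ))
    (hη : ∀ γU ∈ CMRat L dV, ∀ γ ∈ CMRat L dW, η (γU, γ) = 1)
    (SK : Set (CMSchwartz L n))
    (hSK : ∀ (h : CMAdelic L dW) (Φ : CMSchwartz L n), Φ ∈ SK →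
      cmPairRepTwist L e dV hdV hdV0 dW hdW hdW0 hGR η (1, h) Φ ∈ SK) :
    ThetaKernelDatum (CMAdelic L dV × CMAdelic L dW)
      (repWeilThetaDatum (↥(maximalRealSubfield L)) (Fin n)
        (cmPairRepTwist L e dV hdV hdV0 dW hdW hdW0 hGR η).toHomUnits
        (((CMRat L dV).prod (CMRat L dW) : Subgroup (CMAdelic L dV × CMAdelic L dW)) :
          Set (CMAdelic L dV × CMAdelic L dW))).ThetaTop
      (CMAdelic L dV) (CMRat L dV) (CMAdelic L dW) (CMRat L dW) :=
  ThetaKernelDatum.adelicOfDualPairRep (ΓU := CMRat L dV) (Γ := CMRat L dW)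
    (cmPairRepTwist L e dV hdV hdV0 dW hdW hdW0 hGR η)
    (hasThetaMajorants_cmPairRepTwist L e dV hdV hdV0 dW hdW hdW0 hGR η hρ hηc)
    (fun _ hγU _ hγ => cmPairRepTwist_toHomUnits_mem_thetaStabilizer L e dV hdV hdV0 dW hdW hdW0 hGR η hη hγU hγ)
    SK hSK

variable
  (hρ : HasThetaMajorants fun (p : CMAdelic L dV × CMAdelic L dW) (Φ : CMSchwartz L n) =>
    adelicMpCont.omega (↥(maximalRealSubfield L)) (Fin n) (CMGram L e dV hdV dW hdW)
      (cmPairSplitting L e dV hdV hdV0 dW hdW hdW0 hGR p) Φ)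
  (hηc : Continuous fun p => ((η p : ℂˣ) : ℂ))
  (hη : ∀ γU ∈ CMRat L dV, ∀ γ ∈ CMRat L dW, η (γU, γ) = 1)
  (SK : Set (CMSchwartz L n))
  (hSK : ∀ (h : CMAdelic L dW) (Φ : CMSchwartz L n), Φ ∈ SK →
    cmPairRepTwist L e dV hdV hdV0 dW hdW hdW0 hGR η (1, h) Φ ∈ SK)

/-- the lift of the normalised CM datum is the identity. [folklore] -/
theorem cmThetaKernelDatumTwist_s :
    (cmThetaKernelDatumTwist L e dV hdV hdV0 dW hdW hdW0 hGR η hρ hηc hη SK hSK).s = MonoidHom.id _ := rfl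

/-- the Weil action of the normalised CM datum: `W.act p Φ = ω_ψ((s_pair ⊗ η) p) Φ = η(p) • ω_ψ(s_pair p) Φ`.
[cite: Weil1964, Chap. III n° 41 p. 193] -/
theorem cmThetaKernelDatumTwist_act (p : CMAdelic L dV × CMAdelic L dW) (Φ : CMSchwartz L n) :
    (cmThetaKernelDatumTwist L e dV hdV hdV0 dW hdW hdW0 hGR η hρ hηc hη SK hSK).W.act p Φ =
      ((η p : ℂˣ) : ℂ) • cmPairRep L e dV hdV hdV0 dW hdW hdW0 hGR p Φ :=
  cmPairRepTwist_apply_eq_smul L e dV hdV hdV0 dW hdW hdW0 hGR η p Φ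

/-- the `K`-type set of the normalised CM datum is the given `SK`. [folklore] -/
theorem cmThetaKernelDatumTwist_SK :
    (cmThetaKernelDatumTwist L e dV hdV hdV0 dW hdW hdW0 hGR η hρ hηc hη SK hSK).SK = SK := rfl

/-- **the theta kernel in the normalised splitting**: `θ_Φ(x, h) = Θ(ω_ψ((s_pair ⊗ η)(x⁻¹, h⁻¹)) Φ)`.
[cite: Weil1964, Chap. III n° 41 Thm 6 p. 193] -/
theorem cmThetaKernelDatumTwist_thetaFun_mk (Φ : CMSchwartz L n) (x : CMAdelic L dV) (h : CMAdelic L dW) :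
    (cmThetaKernelDatumTwist L e dV hdV hdV0 dW hdW hdW0 hGR η hρ hηc hη SK hSK).thetaFun Φ (x, h) =
      thetaDistLM (↥(maximalRealSubfield L)) (Fin n)
        (cmPairRepTwist L e dV hdV hdV0 dW hdW hdW0 hGR η (x⁻¹, h⁻¹) Φ) := rfl

/-- the theta kernel in the normalised splitting is continuous. [folklore] -/
theorem continuous_cmThetaKernelDatumTwist_thetaFun (Φ : CMSchwartz L n) :
    Continuous ((cmThetaKernelDatumTwist L e dV hdV hdV0 dW hdW hdW0 hGR η hρ hηc hη SK hSK).thetaFun Φ) :=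
  (cmThetaKernelDatumTwist L e dV hdV hdV0 dW hdW hdW0 hGR η hρ hηc hη SK hSK).continuous_thetaFun Φ

/-- the theta kernel in the normalised splitting is right-invariant under `U(diag dV)(L⁺) × U(diag dW)(L⁺)`.
[cite: Weil1964, Chap. III n° 41 Thm 6 p. 193] -/
theorem cmThetaKernelDatumTwist_thetaFun_mul_right (Φ : CMSchwartz L n) (p : CMAdelic L dV × CMAdelic L dW)
    {γU : CMAdelic L dV} (hγU : γU ∈ CMRat L dV) {γ : CMAdelic L dW} (hγ : γ ∈ CMRat L dW) :
    (cmThetaKernelDatumTwist L e dV hdV hdV0 dW hdW hdW0 hGR η hρ hηc hη SK hSK).thetaFun Φ (p * (γU, γ)) =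
      (cmThetaKernelDatumTwist L e dV hdV hdV0 dW hdW hdW0 hGR η hρ hηc hη SK hSK).thetaFun Φ p :=
  (cmThetaKernelDatumTwist L e dV hdV hdV0 dW hdW hdW0 hGR η hρ hηc hη SK hSK).thetaFun_mul_right Φ p hγU hγ

end Twist

/-! ## §2. The anti-diagonal centre `Z⁻ = {(u · 1_V, u⁻¹ · 1_W)}` -/

section Center

variable (L : Type) [Field L] [NumberField L] [IsCMField L] {N M n : ℕ} (e : Fin N × Fin M ≃ Fin n)
variable (dV : Fin N → L) (hdV : ∀ i, IsCMField.complexConj L (dV i) = dV i) (hdV0 : ∀ i, dV i ≠ 0)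
variable (dW : Fin M → L) (hdW : ∀ i, IsCMField.complexConj L (dW i) = dW i) (hdW0 : ∀ i, dW i ≠ 0)
variable (hGR : (cmSplittingDatum L e dV hdV hdV0 dW hdW hdW0).CompatibleSplitting)
variable (η : CMAdelic L dV × CMAdelic L dW →* ℂˣ)
variable (u : CMAdelicOne L)

/-- **the Gelbart–Rogawski pair splitting is trivial on the anti-diagonal centre**:
`s_pair(u · 1_V, u⁻¹ · 1_W) = s((u · 1_V) ⊗ 1 · 1 ⊗ (u⁻¹ · 1_W)) = s(1) = 1` — `s_pair` is the restriction of a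
homomorphism on `G₁(𝔸)` and `(u · 1_V, u⁻¹ · 1_W) ↦ 1 ∈ G₁(𝔸)`
(`UnitaryGroup.adelicInl_adelicCenter_mul_adelicInr_adelicCenter_inv`). [folklore] -/
theorem cmPairSplitting_center :
    cmPairSplitting L e dV hdV hdV0 dW hdW hdW0 hGR
        (CMCenter L dV u, CMCenter L dW u⁻¹) = 1 :=
  (pairSplitting_apply (↥(maximalRealSubfield L)) L (IsCMField.complexConj L) N M e (Matrix.diagonal dV)
      (Matrix.diagonal dW) _ _).trans
    ((DFunLike.congr_arg _
        (UnitaryGroup.adelicInl_adelicCenter_mul_adelicInr_adelicCenter_inv (↥(maximalRealSubfield L)) L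
          (IsCMField.complexConj L) N M (Matrix.diagonal dV) (Matrix.diagonal dW) u)).trans
      (map_one _))

/-- hence `ω_ψ ∘ s_pair` acts trivially on the anti-diagonal centre. [folklore] -/
theorem cmPairRep_center (Φ : CMSchwartz L n) :
    cmPairRep L e dV hdV hdV0 dW hdW hdW0 hGR
        (CMCenter L dV u, CMCenter L dW u⁻¹) Φ = Φ :=
  LinearMap.congr_fun
    ((DFunLike.congr_arg (adelicMpCont.omega (↥(maximalRealSubfield L)) (Fin n) (CMGram L e dV hdV dW hdW))
        (cmPairSplitting_center L e dV hdV hdV0 dW hdW hdW0 hGR u)).trans (map_one _)) Φ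

/-- **the normalised splitting on the anti-diagonal centre is the central scalar `(1, η(u · 1_V, u⁻¹ · 1_W) · id)`**.
[cite: GelbartRogawski1991, §3.1 Remark p. 457 L4–13] -/
theorem cmPairSplittingTwist_center :
    cmPairSplittingTwist L e dV hdV hdV0 dW hdW hdW0 hGR η
        (CMCenter L dV u, CMCenter L dW u⁻¹) =
      adelicMpCont.ofScalar (↥(maximalRealSubfield L)) (Fin n) (CMGram L e dV hdV dW hdW)
        (η (CMCenter L dV u, CMCenter L dW u⁻¹)) :=
  (cmPairSplittingTwist_apply L e dV hdV hdV0 dW hdW hdW0 hGR η _).trans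
    ((congrArg
          (adelicMpCont.ofScalar (↥(maximalRealSubfield L)) (Fin n) (CMGram L e dV hdV dW hdW)
              (η (CMCenter L dV u, CMCenter L dW u⁻¹)) * ·)
        (cmPairSplitting_center L e dV hdV hdV0 dW hdW hdW0 hGR u)).trans
      (mul_one _))

/-- **THE CENTRAL CHARACTER OF THE NORMALISED CM DATUM ON `Z⁻` IS `η|_{Z⁻}`**:
`(ω_ψ ∘ (s_pair ⊗ η))(u · 1_V, u⁻¹ · 1_W) Φ = η(u · 1_V, u⁻¹ · 1_W) • Φ`. [folklore] -/
theorem cmPairRepTwist_center (Φ : CMSchwartz L n) :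
    cmPairRepTwist L e dV hdV hdV0 dW hdW hdW0 hGR η
        (CMCenter L dV u, CMCenter L dW u⁻¹) Φ =
      ((η (CMCenter L dV u, CMCenter L dW u⁻¹) : ℂˣ) : ℂ) • Φ :=
  (cmPairRepTwist_apply_eq_smul L e dV hdV hdV0 dW hdW hdW0 hGR η _ Φ).trans
    (congrArg (((η _ : ℂˣ) : ℂ) • ·) (cmPairRep_center L e dV hdV hdV0 dW hdW hdW0 hGR u Φ))

/-- **the central-character constraint on the normalising character**: `η(u · 1_V, u⁻¹ · 1_W) = β(u)` for all
`u ∈ U(1)(𝔸_{L⁺})`, for a prescribed character `β` of `U(1)(𝔸_{L⁺})` — e.g. Kudla's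
`β(u) = β_{V,χ_V}(u) β_{W,μ}(u⁻¹)` ([HarrisKudlaSweet1996, (1.14)–(1.15) p. 952]), which is what a `K_∞`-type read in
Kudla's normalisation prescribes on `Z⁻`.  A hypothesis predicate: nothing is asserted.
[cite: HarrisKudlaSweet1996, (1.14)–(1.15) p. 952] -/
def CenterCharEq (β : CMAdelicOne L →* ℂˣ) : Prop :=
  ∀ u : CMAdelicOne L,
    η (CMCenter L dV u, CMCenter L dW u⁻¹) = β u

/-- under the constraint, the normalised CM datum has central character `β` on `Z⁻`:
`(ω_ψ ∘ (s_pair ⊗ η))(u · 1_V, u⁻¹ · 1_W) Φ = β(u) • Φ`. [cite: HarrisKudlaSweet1996, (1.14)–(1.15) p. 952] -/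
theorem cmPairRepTwist_center_of_centerCharEq {β : CMAdelicOne L →* ℂˣ}
    (hβ : CenterCharEq L dV dW η β) (Φ : CMSchwartz L n) :
    cmPairRepTwist L e dV hdV hdV0 dW hdW hdW0 hGR η
        (CMCenter L dV u, CMCenter L dW u⁻¹) Φ =
      ((β u : ℂˣ) : ℂ) • Φ :=
  (cmPairRepTwist_center L e dV hdV hdV0 dW hdW hdW0 hGR η u Φ).trans
    (congrArg (fun z : ℂˣ => (z : ℂ) • Φ) (hβ u))

end Center

end UnitaryDualPair

end Literature.NumberTheory.GelbartRogawski1991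

end

/-! ### Build-lane note (ops-buildfix G11b-3 recipe v2, LEDGER B13-1/B14-5/B14-7, 2026-08-22)
`lean -o` (the hub build lane, never `lean`/the gate check) runs Lean 4.32's library-suggestion indexers
(`Lean.LibrarySuggestions.SymbolFrequency` / `SineQuaNon`, from their `exportEntriesFn`) over the statement of every local
theorem constant that is not a denied premise; on this family's statements (very large dependent binder telescopes) that fold
runs for tens of minutes (incident G11b-3, run/shared/lean/ops/buildfix/G11b-3-DOSSIER.md). `isDeniedPremise` skips
`[implicit_reducible]` constants before any fold, and the status is inert on theorems (Meta never unfolds `thmInfo`).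
v2 form: ONE file-final, top-level `local` attribute — it goes through the synchronous scoped reducibility extension that
`getReducibilityStatusCore` reads first, so it needs no `set_option Elab.async false` (parallel elaboration stays on), also
reaches auto-realized `*.congr_simp` / structure-projection theorem constants, is never popped before export, and is not
exported. No statement or proof is changed. -/
set_option allowUnsafeReducibility true in
attribute [local implicit_reducible]
  Literature.NumberTheory.GelbartRogawski1991.UnitaryDualPair.cmPairSplittingTwist_apply
  Literature.NumberTheory.GelbartRogawski1991.UnitaryDualPair.proj_cmPairSplittingTwist
  Literature.NumberTheory.GelbartRogawski1991.UnitaryDualPair.continuous_cmPairSplittingTwist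
  Literature.NumberTheory.GelbartRogawski1991.UnitaryDualPair.cmPairRepTwist_apply
  Literature.NumberTheory.GelbartRogawski1991.UnitaryDualPair.cmPairRepTwist_apply_eq_smul
  Literature.NumberTheory.GelbartRogawski1991.UnitaryDualPair.cmPairRepTwist_toHomUnits_mem_thetaStabilizer
  Literature.NumberTheory.GelbartRogawski1991.UnitaryDualPair.hasThetaMajorants_cmPairRepTwist
  Literature.NumberTheory.GelbartRogawski1991.UnitaryDualPair.cmThetaKernelDatumTwist_s
  Literature.NumberTheory.GelbartRogawski1991.UnitaryDualPair.cmThetaKernelDatumTwist_act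
  Literature.NumberTheory.GelbartRogawski1991.UnitaryDualPair.cmThetaKernelDatumTwist_SK
  Literature.NumberTheory.GelbartRogawski1991.UnitaryDualPair.cmThetaKernelDatumTwist_thetaFun_mk
  Literature.NumberTheory.GelbartRogawski1991.UnitaryDualPair.continuous_cmThetaKernelDatumTwist_thetaFun
  Literature.NumberTheory.GelbartRogawski1991.UnitaryDualPair.cmThetaKernelDatumTwist_thetaFun_mul_right
  Literature.NumberTheory.GelbartRogawski1991.UnitaryDualPair.cmPairSplitting_center
  Literature.NumberTheory.GelbartRogawski1991.UnitaryDualPair.cmPairRep_center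
  Literature.NumberTheory.GelbartRogawski1991.UnitaryDualPair.cmPairSplittingTwist_center
  Literature.NumberTheory.GelbartRogawski1991.UnitaryDualPair.cmPairRepTwist_center
  Literature.NumberTheory.GelbartRogawski1991.UnitaryDualPair.cmPairRepTwist_center_of_centerCharEq
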